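import Summits.BirchSwinnertonDyer.Rank1Residual.Partition.CornersSharp
import Literature.NumberTheory.EllipticCurves.Rank1Residual.X1RankOne
import HarnessLib

/-!
# The good ORDINARY axis at `p ≥ 5`: the Eisenstein–anomalous corner X1 SHRINKS TO ITS TYPE-A PART
# modulo the per-pair Schneider certificate (cell `b2b-bsdres`, RESIDUAL-MAP.md §A row
# 'reducible, anomalous, GV parity holds' × `r = 1` = §I N1′; rmap-1 gen 7)

HONEST FRAMING (run/shared/lean/b2b/bsd-rank1-residual/, verbatim in every file): the goal of the
cell is to DELETE the COMBINATION-SHAPED residual classes of the Birch–Swinnerton-Dyer formula for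
ALL analytic-rank `≤ 1` elliptic curves over `ℚ` — "full BSD formula for every rank `≤ 1` curve in
class `C`" assembled STRICTLY from published theorems — so that the rank-`≤ 1` remainder becomes
exactly the CONSTRUCTION-SHAPED classes, which are TYPED (missing-input `Prop`s), NOT attempted.
This is not "finishing BSD". Theorems only; NO definition, NO named fact introduced here; every
published theorem enters as one of the tree's existing named Literature facts BY NAME; nothing
about any particular curve is asserted; no label changes.

## What this file records

`Partition/CornersSharp.lean` (rmap-1 gen 5) states the §A headline at `p ≥ 5`: for non-CM `E/ℚ`
of analytic rank `r ≤ 1` and a good ORDINARY prime `p ≥ 5`, `BSD(E,p)` holds outside the corner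
`ClassX1 ∨ ClassX9`, from SEVEN named facts. The corner X1 is the Eisenstein ANOMALOUS class
`2 < p ∧ red ∧ good ∧ anom ∧ ¬(r = 0 ∧ gvpar)`; it has three parts (RESIDUAL-MAP §A, §I N1 / N1′ /
N1″): type A in rank one (X1a: `r = 1 ∧ ¬gvpar`), type A in rank zero (X1b-A: `r = 0 ∧ ¬gvpar`),
and type B in rank one (`r = 1 ∧ gvpar`). On the TYPE-B part Mazur's main conjecture is PUBLISHED —
Greenberg–Vatsal 2000 Thm. (1.3) carries no anomaly hypothesis — and the x1b seat's Literature theorem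
`X1.bsdp_of_gvPar_of_rank_one` (`Rank1Residual/X1RankOne.lean`) gives `BSD(E,p)` there from
PUBLISHED named facts MODULO ONE per-pair certificate: Schneider's non-degeneracy of the canonical
cyclotomic `p`-adic height on `E(ℚ) ⊗ ℚ_p` (`SchneiderConjecture Dh` for the canonical datum `Dh`;
in rank one `⟺ [T¹]L_p(E,T) ≠ 0`; a finite `p`-adic computation when it holds, Schneider's 1985
conjecture class-wide).

This file lifts that to the Partition level, i.e. to the shape of the coordinator's headline
('explicit corners' — ruling (A), 2026-08-20T22:22Z): GRANTED THE PAIR'S SCHNEIDER CERTIFICATE, the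
§A corner at `p ≥ 5` is `(ClassX1 ∧ ¬GVPar) ∨ ClassX9` — the anomalous TYPE-A pairs and the small
irreducible images only:

* `analyticRank_eq_one_of_classX1_of_gvPar` — on X1, GV parity forces `r = 1` (the rank-zero
  GV-parity pairs are row C7, outside X1 by definition);
* `bsdp_of_classX1_of_gvPar_of_schneider` — X1 ∧ gvpar ∧ certificate ⇒ `BSD(E,p)` (`p ≥ 5`), from
  Greenberg–Vatsal 2000 Thm. (1.3) (`hGV`), Perrin-Riou–Schneider = Balakrishnan–Müller–Stein 2016
  Thm. 1.7 (`hS`), Perrin-Riou 1987 §1.4 (`hPR`), modularity (`hmodP`), GZK (`hGZK`) — a one-line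
  wrapper of `X1.bsdp_of_gvPar_of_rank_one`;
* `bsdp_goodOrd_of_five_le_of_schneider_sharp` — **non-CM, `r ≤ 1`, good ordinary `p ≥ 5`, the
  pair's Schneider certificate: `BSD(E,p)` unless `(ClassX1 ∧ ¬GVPar) ∨ ClassX9`**, NINE named facts
  (the seven of `bsdp_goodOrd_of_five_le_sharp` + `hS`, `hPR`); partition form
  `bsdp_or_typeA_or_classX9_of_five_le_of_schneider`;
* `bsdp_goodOrd_of_five_le_allCurves_of_schneider_sharp` — every `E/ℚ` (+ `hCM`, `hKob` on the CM
  branch, where no corner is met at a good odd prime);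
* `bsdp_goodOrd_or_mult_of_five_le_of_schneider_sharp` — the coordinator's domain at `p ≥ 5` ('good
  ordinary, or multiplicative with `r = 0`'; + Skinner 2016 Thm. C `hSk`): corners
  `(X1 ∧ ¬gvpar) ∨ X9 ∨ X11a ∨ X2`.

The certificate binder `hSch` is PER PAIR (a hypothesis on `(W, p)`, like the `μ_an = 0`
certificates of the X11a chain), not a class-level fact; nothing is booked by this file. At `p = 3`
the tree's height / Perrin-Riou–Schneider / Perrin-Riou facts carry `5 ≤ p`, so the type-B rank-one
pairs at `3` stay inside the corner (RESIDUAL-MAP §A: 'stands with the X1 row / Keller–Yin'). Flags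
that ride: as in `CornersSharp` (`BCS25-IMC-equiv@BSTW` with `hBCS`, `CGS25-BST-Thm311` with `hCGS`
informational, `GV-chain` with `hGV`/`hGr` literal); `hS` / `hPR` are PUBLISHED (Balakrishnan–Müller–
Stein 2016 Thm. 1.7 after Perrin-Riou 1993 / Schneider 1985; Perrin-Riou, Invent. Math. 89 (1987)
§1.4 Cor. 1.8). No mark of RESIDUAL-MAP moves: the type-B rank-one cell is NEEDS X_A1′ = this
certificate (§I N1′, 'COMBINATION (certificate-shaped)').

References: RESIDUAL-MAP.md §A (row 'reducible, anomalous, GV parity holds', r = 1 cell; RMAP NOTE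
22:08Z; §A CORNER PREDICATE (K1)), §I N1′; `Partition/CornersSharp.lean`;
`Literature/…/Rank1Residual/X1RankOne.lean` (x1b GEN 3); [GreenbergVatsal2000] Thm. (1.3);
[PerrinRiou1987] §1.4 Cor. 1.8; [BalakrishnanMullerStein2015] Thm. 1.7; [Schneider1985];
[Miller2011LMS] Def. 1.1.
-/

namespace Summit.BirchSwinnertonDyer.Rank1Residual

open WeierstrassCurve Literature.NumberTheory.EllipticCurves
  Literature.NumberTheory.EllipticCurves.Rank1Residual Literature.NumberTheory.EllipticCurves.ModularForms
  Literature.NumberTheory.EllipticCurves.Wuthrich2014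
  Literature.NumberTheory.EllipticCurves.Rank1Residual.Typed
open scoped NumberField

section Curve

variable {W : WeierstrassCurve ℚ} [W.IsElliptic] [W.IsGloballyMinimal] {p : ℕ} [Fact p.Prime]

/-! ### On X1, GV parity forces rank one -/

omit [W.IsElliptic] in
/-- **On class X1 the Greenberg–Vatsal parity condition forces analytic rank one** (given `r ≤ 1`):
`ClassX1 W p` contains the clause `¬(W.analyticRank = 0 ∧ GVPar W p)` — the rank-zero GV-parity
pairs are row C7 (Greenberg–Vatsal + Greenberg Thm. 4.1), not X1. [folklore] -/
theorem analyticRank_eq_one_of_classX1_of_gvPar (hr : W.analyticRank ≤ 1) (hX1 : ClassX1 W p)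
    (hpar : GVPar W p) : W.analyticRank = 1 := by
  obtain ⟨-, -, -, -, h0⟩ := hX1
  by_contra h1
  exact h0 ⟨by omega, hpar⟩

/-! ### The type-B part of X1 exits the corner under the certificate -/

/-- **X1 ∧ gvpar ∧ Schneider certificate ⇒ `BSD(E,p)`** (`p ≥ 5`, `r ≤ 1`): the anomalous TYPE-B
pairs. Mazur's main conjecture is Greenberg–Vatsal 2000 Thm. (1.3) + Kato (`hGV`; no anomaly and no
rank hypothesis in (1.3)); the rank-one leading-term comparison is Perrin-Riou–Schneider (`hS`) +
Perrin-Riou 1987 (`hPR`) + modularity (`hmodP`) + GZK (`hGZK`) under the pair's certificate `hSch`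
— the x1b seat's `X1.bsdp_of_gvPar_of_rank_one`, with the rank read off X1 + gvpar
(`analyticRank_eq_one_of_classX1_of_gvPar`). [cite: GreenbergVatsal2000, Thm. (1.3)]
[cite: PerrinRiou1987, §1.4 Cor. 1.8] [cite: BalakrishnanMullerStein2015, Thm. 1.7] -/
theorem bsdp_of_classX1_of_gvPar_of_schneider
    (hGV : GreenbergVatsal2000.thm13_charIdeal_eq_of_gvPar)
    (hS : Schneider1985_order_charGenerator) (hPR : perrinRiou_rankOne_leadingTerms)
    (hmodP : nonempty_modularParametrizationData)
    (hGZK : rank_eq_analyticRank_of_analyticRank_le_one)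
    (hr : W.analyticRank ≤ 1) (h5 : 5 ≤ p) (hX1 : ClassX1 W p) (hpar : GVPar W p)
    (hSch : ∀ Dh : PAdicHeightData W p, Dh.IsCanonical → SchneiderConjecture Dh) : BSDp W p :=
  X1.bsdp_of_gvPar_of_rank_one hGV hS hPR hmodP hGZK W p hX1 h5
    (analyticRank_eq_one_of_classX1_of_gvPar hr hX1 hpar) hpar hSch

/-! ### The §A headline at `p ≥ 5`, corner sharpened to its type-A part modulo the certificate -/

/-- **SHARP MODULO THE SCHNEIDER CERTIFICATE, non-CM: NINE named facts.** For every non-CM `E/ℚ`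
(globally minimal `W`) of analytic rank `≤ 1` and every good ORDINARY prime `p ≥ 5` at which the
canonical cyclotomic `p`-adic height on `E(ℚ)` is non-degenerate (`hSch`, the pair's Schneider
certificate), `BSD(E,p)` holds unless `(E, p)` is Eisenstein-anomalous of TYPE A
(`ClassX1 W p ∧ ¬ GVPar W p`: X1a in rank one, X1b-A in rank zero) or lies in X9 (image
`5Ns/5S4/7Ns`), granted Burungale–Castella–Skinner 2025 Cor. 1.3.1 (`hBCS`, PUB\*), GZK (`hGZK`),
Castella–Grossi–Skinner 2025 Thm. D (`hCGS`), Greenberg–Vatsal 2000 Thm. (1.3) (`hGV`) with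
Greenberg 1999 Thm. 4.1 (`hGr`), modularity (`hmod`, `hmodP`), Perrin-Riou–Schneider (`hS`),
Perrin-Riou 1987 (`hPR`). Outside X1: `CornersSharp.bsdp_goodOrd_of_five_le_sharp`; on X1 the
hypothesis leaves the GV-parity pairs, closed by `bsdp_of_classX1_of_gvPar_of_schneider`.
RESIDUAL-MAP §A / §I N1′ in kernel form. [folklore] -/
theorem bsdp_goodOrd_of_five_le_of_schneider_sharp
    (hBCS : BurungaleCastellaSkinner2025.cor131_padicValRat_bsd_rank_le_one)
    (hGZK : rank_eq_analyticRank_of_analyticRank_le_one)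
    (hCGS : CastellaGrossiSkinner2025.thmD_padicValRat_bsd_rank_le_one)
    (hGV : GreenbergVatsal2000.thm13_charIdeal_eq_of_gvPar) (hGr : greenberg_charValue_rankZero)
    (hmod : hasEntireLFunction_rat) (hmodP : nonempty_modularParametrizationData)
    (hS : Schneider1985_order_charGenerator) (hPR : perrinRiou_rankOne_leadingTerms)
    (hcm : ¬ W.HasCM) (hr : W.analyticRank ≤ 1) (hgo : GoodOrd W p) (h5 : 5 ≤ p)
    (hSch : ∀ Dh : PAdicHeightData W p, Dh.IsCanonical → SchneiderConjecture Dh)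
    (hA : ¬ (ClassX1 W p ∧ ¬ GVPar W p)) (hX9 : ¬ ClassX9 W p) : BSDp W p := by
  by_cases hX1 : ClassX1 W p
  · have hpar : GVPar W p := by
      by_contra hnp
      exact hA ⟨hX1, hnp⟩
    exact bsdp_of_classX1_of_gvPar_of_schneider hGV hS hPR hmodP hGZK hr h5 hX1 hpar hSch
  · exact bsdp_goodOrd_of_five_le_sharp hBCS hGZK hCGS hGV hGr hmod hmodP hcm hr hgo h5 hX1 hX9

/-- **Partition form at `p ≥ 5` under the certificate (non-CM, good ordinary):
`BSD(E,p) ∨ (X1 ∧ ¬gvpar) ∨ X9`** from the same nine named facts. [folklore] -/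
theorem bsdp_or_typeA_or_classX9_of_five_le_of_schneider
    (hBCS : BurungaleCastellaSkinner2025.cor131_padicValRat_bsd_rank_le_one)
    (hGZK : rank_eq_analyticRank_of_analyticRank_le_one)
    (hCGS : CastellaGrossiSkinner2025.thmD_padicValRat_bsd_rank_le_one)
    (hGV : GreenbergVatsal2000.thm13_charIdeal_eq_of_gvPar) (hGr : greenberg_charValue_rankZero)
    (hmod : hasEntireLFunction_rat) (hmodP : nonempty_modularParametrizationData)
    (hS : Schneider1985_order_charGenerator) (hPR : perrinRiou_rankOne_leadingTerms)
    (hcm : ¬ W.HasCM) (hr : W.analyticRank ≤ 1) (hgo : GoodOrd W p) (h5 : 5 ≤ p)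
    (hSch : ∀ Dh : PAdicHeightData W p, Dh.IsCanonical → SchneiderConjecture Dh) :
    BSDp W p ∨ (ClassX1 W p ∧ ¬ GVPar W p) ∨ ClassX9 W p := by
  by_cases hA : ClassX1 W p ∧ ¬ GVPar W p
  · exact Or.inr (Or.inl hA)
  · by_cases hX9 : ClassX9 W p
    · exact Or.inr (Or.inr hX9)
    · exact Or.inl (bsdp_goodOrd_of_five_le_of_schneider_sharp hBCS hGZK hCGS hGV hGr hmod hmodP hS
        hPR hcm hr hgo h5 hSch hA hX9)

/-- **SHARP MODULO THE CERTIFICATE, EVERY `E/ℚ` (CM included): ELEVEN named facts** — the nine of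
`bsdp_goodOrd_of_five_le_of_schneider_sharp` plus, on the CM branch (no corner at a good odd prime,
`Corners.bsdp_cm_of_good_or_mult_rankZero`), Rubin 1991 ∧ Burungale–Flach 2024 (`hCM`) and
Kobayashi 2013 Cor. 1.4 (`hKob`, PUB[sec] flag `KOB13-primary-unread`). [folklore] -/
theorem bsdp_goodOrd_of_five_le_allCurves_of_schneider_sharp
    (hBCS : BurungaleCastellaSkinner2025.cor131_padicValRat_bsd_rank_le_one)
    (hGZK : rank_eq_analyticRank_of_analyticRank_le_one)
    (hCGS : CastellaGrossiSkinner2025.thmD_padicValRat_bsd_rank_le_one)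
    (hGV : GreenbergVatsal2000.thm13_charIdeal_eq_of_gvPar) (hGr : greenberg_charValue_rankZero)
    (hmod : hasEntireLFunction_rat) (hmodP : nonempty_modularParametrizationData)
    (hS : Schneider1985_order_charGenerator) (hPR : perrinRiou_rankOne_leadingTerms)
    (hCM : bsdTriple_of_hasCM_of_L_one_ne_zero) (hKob : Kobayashi2013.cor14_bsdp_of_cm_rank_one)
    (hr : W.analyticRank ≤ 1) (hgo : GoodOrd W p) (h5 : 5 ≤ p)
    (hSch : ∀ Dh : PAdicHeightData W p, Dh.IsCanonical → SchneiderConjecture Dh)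
    (hA : ¬ (ClassX1 W p ∧ ¬ GVPar W p)) (hX9 : ¬ ClassX9 W p) : BSDp W p := by
  by_cases hcm : W.HasCM
  · exact bsdp_cm_of_good_or_mult_rankZero hCM hKob hmod hr hcm (by omega) (Or.inl hgo.1)
  · exact bsdp_goodOrd_of_five_le_of_schneider_sharp hBCS hGZK hCGS hGV hGr hmod hmodP hS hPR hcm hr
      hgo h5 hSch hA hX9

/-! ### The coordinator's domain at `p ≥ 5` under the certificate -/

/-- **SHARP MODULO THE CERTIFICATE, non-CM, `p ≥ 5`, 'good ORDINARY, or MULTIPLICATIVE with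
`r = 0`': TEN named facts** (+ Skinner 2016 Thm. C `hSk`, row C1). For every non-CM `E/ℚ` of
analytic rank `r ≤ 1` and every prime `p ≥ 5` with the pair's Schneider certificate, such that `p`
is good ordinary, or `p` is multiplicative and `r = 0`, `BSD(E,p)` holds outside the corners
`X1 ∧ ¬gvpar` (anomalous type A), X9 (ordinary axis), X11a ('(ram) fails') and X2 (`E[p]`
reducible) (multiplicative axis). On the multiplicative axis the certificate is idle
(`Corners.bsdp_mult_rankZero_of_not_corner`). [folklore] -/
theorem bsdp_goodOrd_or_mult_of_five_le_of_schneider_sharp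
    (hBCS : BurungaleCastellaSkinner2025.cor131_padicValRat_bsd_rank_le_one)
    (hGZK : rank_eq_analyticRank_of_analyticRank_le_one)
    (hCGS : CastellaGrossiSkinner2025.thmD_padicValRat_bsd_rank_le_one)
    (hGV : GreenbergVatsal2000.thm13_charIdeal_eq_of_gvPar) (hGr : greenberg_charValue_rankZero)
    (hmod : hasEntireLFunction_rat) (hmodP : nonempty_modularParametrizationData)
    (hS : Schneider1985_order_charGenerator) (hPR : perrinRiou_rankOne_leadingTerms)
    (hSk : Skinner2016.thmC_padicValRat_bsd_rank_zero)
    (hcm : ¬ W.HasCM) (hr : W.analyticRank ≤ 1) (h5 : 5 ≤ p)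
    (hdom : GoodOrd W p ∨ (Mult W p ∧ W.analyticRank = 0))
    (hSch : ∀ Dh : PAdicHeightData W p, Dh.IsCanonical → SchneiderConjecture Dh)
    (hA : ¬ (ClassX1 W p ∧ ¬ GVPar W p)) (hX9 : ¬ ClassX9 W p) (hX11a : ¬ ClassX11a W p)
    (hX2 : ¬ ClassX2 W p) : BSDp W p := by
  rcases hdom with hgo | ⟨hm, hr0⟩
  · exact bsdp_goodOrd_of_five_le_of_schneider_sharp hBCS hGZK hCGS hGV hGr hmod hmodP hS hPR hcm hr
      hgo h5 hSch hA hX9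
  · exact bsdp_mult_rankZero_of_not_corner hSk hmod hGZK (by omega) hm hr0 hX11a hX2

end Curve

end Summit.BirchSwinnertonDyer.Rank1Residual
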